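import Mathlib
import Summits.Ventures.PercRepro2.Defs
import Summits.Ventures.PercRepro2.Independence
import Summits.Ventures.PercRepro2.Harris
import Summits.Ventures.PercRepro2.Graph
import Summits.Ventures.PercRepro2.Exploration
import Summits.Ventures.PercRepro2.Events
import Summits.Ventures.PercRepro2.ObsIndependence
import Summits.Ventures.PercRepro2.CDRequired
import Summits.Ventures.PercRepro2.CutVertexDefs
import Summits.Ventures.PercRepro2.CDCutVertex
import Summits.Ventures.PercRepro2.CDCutO

/-!
# The `a₃`-required anti-correlation (AC) transfers across a cut vertex — in all three directions
(blind cell PercRepro2, mine-a g36; MINE-A.md §91)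

`Q = {a₁ ↮ a₂}`, `U = {C₁ ∈ 𝓔}`, `e = {a₁ ↔ a₃}`, `f = {a₂ ↔ o}`.  (AC) at `(a₁, a₂, a₃, o)` for the
up-set `𝓔` is `P(Q U e f)·P(Q e) ≤ P(Q U e)·P(Q e f)`; by `CDRequired.cd_of_required_anticorr` it
implies row 2′CD.  Every class theorem of the row so far (`CDCylinder`, `CDCycle`, `CDNestedRoutes`,
`CDNestedSimplePaths`) proves (AC) for every up-set and every weight vector, and the cut-vertex
theorems `CDCutVertex` / `CDCutCycle` use their far-side hypothesis ONLY through the fibrewise (AC).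
This file isolates the mechanism: (AC) for every up-set is a property that passes across a cut vertex.

* **`a₁` beyond the cut** (`required_anticorr_of_cut_root`): `y` a cut vertex, `a₁ ∈ VA ∪ {y}`,
  `a₂, o ∈ VB`, `a₃ ∈ VB ∪ {y}`.  If (AC) holds at `(y, a₂, a₃, o)` for every up-set under the vector
  with the near side closed, it holds at `(a₁, a₂, a₃, o)` for every up-set.  (The tower of
  `CDCutVertex.required_anticorr_of_cut_cylinder` with the cylinder hypothesis replaced by (AC).)
* **`a₃` beyond the cut** (`required_anticorr_of_cut_far`): `v` a cut vertex, `a₁, a₂, o ∈ VA ∪ {v}`,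
  `a₃ ∈ VB`.  If (AC) holds at `(a₁, a₂, v, o)` for every up-set under the vector with the far side
  closed, it holds at `(a₁, a₂, a₃, o)` for every up-set — the far side is ARBITRARY.  Proof: condition
  on the far-side configuration `S`: on `{a₁ ↔ v in A}` the root cluster is `C_A(a₁) ∪ C_B(v)(S)`, so
  `U` reads as the near-side event `{C_A(a₁) ∈ 𝓔_S}` with the up-set `𝓔_S = {W ∣ W ∪ C_B(v)(S) ∈ 𝓔}`,
  `Q` and `f` are near-side events, `e = {a₁ ↔ v in A} ∩ {v ↔ a₃ in B}`; the tower over the far side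
  (`CDCutVertex.prob_eq_sum_tower` with the sides exchanged) writes the four masses as
  `∑_ω weight p ω · 1_{v ↔ a₃}(S) · P(near-side event)`, the factors `P(Qe)`, `P(Qef)` do not depend on
  `S`, and the fibrewise (AC) at `(a₁, a₂, v, o)` adds up.
* **`o` beyond the cut** (`required_anticorr_of_cut_o`): `z` a cut vertex, `a₁, a₂, a₃ ∈ VA ∪ {z}`,
  `o ∈ VB`, `𝓔` reading only the near side: (AC) at `(a₁, a₂, z, o)` ⟹ (AC) at `(a₁, a₂, a₃, o)`
  (the product law of `CDCutO`).

Corollaries: row 2′CD at `(a₁, a₂, a₃, o)` from (AC) across the cut (`cd_of_cut_root`, `cd_of_cut_far`).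
With the (AC) forms of the class theorems (`CDNestedAC`) this puts the row on every graph whose
block containing the three marks `a₁, a₂, o` (resp. `a₂, a₃, o`) is a proved class and whose other side
is arbitrary — see `CDBlockNested`.  No definition; one seat.
-/

namespace Summit.Ventures.PercRepro2

namespace CDCutAC

section Main

variable {V : Type*} {E : Type*} [Fintype E] [DecidableEq E] [Fintype V] [DecidableEq V]
  {R : Type*} [Field R] [LinearOrder R] [IsStrictOrderedRing R]

variable {ends : E → Sym2 V} {y : V} {VA VB : Set V} {EA EB : Set E} [DecidablePred (· ∈ EA)]
  [DecidablePred (· ∈ EB)]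

omit [Fintype V] [DecidableEq V] [LinearOrder R] [IsStrictOrderedRing R] in
/-- `𝓔_S = {W ∣ W ∪ S ∈ 𝓔}` is an up-set. -/
lemma isUpperSet_union_right {𝓔 : Set (Set V)} (h𝓔 : IsUpperSet 𝓔) (S : Set V) :
    IsUpperSet {W : Set V | W ∪ S ∈ 𝓔} :=
  fun _ _ hWW' hW => h𝓔 (Set.union_subset_union_left S hWW') hW

/-! ## `a₁` beyond the cut -/

omit [Fintype V] [DecidableEq V] in
/-- **(AC) across a cut vertex separating `a₁` from `{a₂, a₃, o}`.** If the far side satisfies (AC) with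
the root `y` for every up-set (under the vector with the near side closed), then (AC) holds at
`(a₁, a₂, a₃, o)` for every up-set `𝓔`. -/
theorem required_anticorr_of_cut_root (p : E → R) (hp : IsProbVec p)
    (h : CutV.IsCut ends y VA VB EA EB) {a₁ a₂ a₃ o : V} (ha₁ : a₁ ∈ VA ∪ {y}) (ha₂ : a₂ ∈ VB)
    (ho : o ∈ VB) (ha₃ : a₃ ∈ VB ∪ {y}) {𝓔 : Set (Set V)} (h𝓔 : IsUpperSet 𝓔)
    (hAC : ∀ 𝓤 : Set (Set V), IsUpperSet 𝓤 →
      prob (fun e => if e ∈ EB then p e else 0) ((connEvent ends y a₂)ᶜ ∩ clusterInEvent ends y 𝓤 ∩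
            connEvent ends y a₃ ∩ connEvent ends a₂ o) *
          prob (fun e => if e ∈ EB then p e else 0) ((connEvent ends y a₂)ᶜ ∩ connEvent ends y a₃) ≤
        prob (fun e => if e ∈ EB then p e else 0) ((connEvent ends y a₂)ᶜ ∩ clusterInEvent ends y 𝓤 ∩
            connEvent ends y a₃) *
          prob (fun e => if e ∈ EB then p e else 0) ((connEvent ends y a₂)ᶜ ∩ connEvent ends y a₃ ∩
            connEvent ends a₂ o)) :
    prob p ((connEvent ends a₁ a₂)ᶜ ∩ clusterInEvent ends a₁ 𝓔 ∩ connEvent ends a₁ a₃ ∩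
          connEvent ends a₂ o) * prob p ((connEvent ends a₁ a₂)ᶜ ∩ connEvent ends a₁ a₃) ≤
      prob p ((connEvent ends a₁ a₂)ᶜ ∩ clusterInEvent ends a₁ 𝓔 ∩ connEvent ends a₁ a₃) *
        prob p ((connEvent ends a₁ a₂)ᶜ ∩ connEvent ends a₁ a₃ ∩ connEvent ends a₂ o) := by
  obtain ⟨e1, e2, e3, e4⟩ := CDCutVertex.required_events_eq h ha₁ ha₂ ho ha₃ 𝓔
  have t1 := CDCutVertex.prob_eq_sum_tower p EA EB h.Edisj (connEvent ends a₁ y) (fun T =>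
    (connEvent ends y a₂)ᶜ ∩ clusterInEvent ends y {W | cluster ends T a₁ ∪ W ∈ 𝓔} ∩
      connEvent ends y a₃ ∩ connEvent ends a₂ o)
  have t2 := CDCutVertex.prob_eq_sum_tower p EA EB h.Edisj (connEvent ends a₁ y) (fun _ =>
    (connEvent ends y a₂)ᶜ ∩ connEvent ends y a₃)
  have t3 := CDCutVertex.prob_eq_sum_tower p EA EB h.Edisj (connEvent ends a₁ y) (fun T =>
    (connEvent ends y a₂)ᶜ ∩ clusterInEvent ends y {W | cluster ends T a₁ ∪ W ∈ 𝓔} ∩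
      connEvent ends y a₃)
  have t4 := CDCutVertex.prob_eq_sum_tower p EA EB h.Edisj (connEvent ends a₁ y) (fun _ =>
    (connEvent ends y a₂)ᶜ ∩ connEvent ends y a₃ ∩ connEvent ends a₂ o)
  rw [e1, e3, e4, e2, t1, t3, t4, t2]
  set w : Config E → R := fun ω => weight p ω * (connEvent ends a₁ y).indicator 1 (restrict EA ω)
    with hw
  have hw0 : ∀ ω, 0 ≤ w ω := fun ω =>
    mul_nonneg (weight_nonneg hp ω) (Set.indicator_apply_nonneg fun _ => zero_le_one)
  set Z := prob p (CutV.sideEvent EB ((connEvent ends y a₂)ᶜ ∩ connEvent ends y a₃)) with hZ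
  set Zf := prob p (CutV.sideEvent EB ((connEvent ends y a₂)ᶜ ∩ connEvent ends y a₃ ∩
    connEvent ends a₂ o)) with hZf
  set X : Config E → R := fun ω => prob p (CutV.sideEvent EB ((connEvent ends y a₂)ᶜ ∩
    clusterInEvent ends y {W | cluster ends (restrict EA ω) a₁ ∪ W ∈ 𝓔} ∩
    connEvent ends y a₃ ∩ connEvent ends a₂ o)) with hX
  set Y : Config E → R := fun ω => prob p (CutV.sideEvent EB ((connEvent ends y a₂)ᶜ ∩
    clusterInEvent ends y {W | cluster ends (restrict EA ω) a₁ ∪ W ∈ 𝓔} ∩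
    connEvent ends y a₃)) with hY
  -- the fibrewise inequality: the far-side (AC) with the up-set `𝓔_T`
  have hfib : ∀ ω, X ω * Z ≤ Y ω * Zf := by
    intro ω
    simp only [hX, hY, hZ, hZf]
    rw [← CDCutVertex.prob_zeroOff_eq_prob_sideEvent, ← CDCutVertex.prob_zeroOff_eq_prob_sideEvent,
      ← CDCutVertex.prob_zeroOff_eq_prob_sideEvent, ← CDCutVertex.prob_zeroOff_eq_prob_sideEvent]
    exact hAC _ (CDCutVertex.isUpperSet_union_left h𝓔 _)
  have hS0 : 0 ≤ ∑ ω, w ω := Finset.sum_nonneg fun ω _ => hw0 ω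
  have sa : ∑ ω, weight p ω * ((connEvent ends a₁ y).indicator 1 (restrict EA ω) * X ω) =
      ∑ ω, w ω * X ω := Finset.sum_congr rfl fun ω _ => by rw [hw]; ring
  have sb : ∑ ω, weight p ω * ((connEvent ends a₁ y).indicator 1 (restrict EA ω) * Y ω) =
      ∑ ω, w ω * Y ω := Finset.sum_congr rfl fun ω _ => by rw [hw]; ring
  have sd : ∑ ω, weight p ω * ((connEvent ends a₁ y).indicator 1 (restrict EA ω) * Z) =
      (∑ ω, w ω) * Z := by
    rw [Finset.sum_mul]; exact Finset.sum_congr rfl fun ω _ => by rw [hw]; ring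
  have sc : ∑ ω, weight p ω * ((connEvent ends a₁ y).indicator 1 (restrict EA ω) * Zf) =
      (∑ ω, w ω) * Zf := by
    rw [Finset.sum_mul]; exact Finset.sum_congr rfl fun ω _ => by rw [hw]; ring
  show (∑ ω, weight p ω * ((connEvent ends a₁ y).indicator 1 (restrict EA ω) * X ω)) *
      (∑ ω, weight p ω * ((connEvent ends a₁ y).indicator 1 (restrict EA ω) * Z)) ≤
    (∑ ω, weight p ω * ((connEvent ends a₁ y).indicator 1 (restrict EA ω) * Y ω)) *
      (∑ ω, weight p ω * ((connEvent ends a₁ y).indicator 1 (restrict EA ω) * Zf))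
  rw [sa, sb, sc, sd]
  have hsum : ∑ ω, w ω * (X ω * Z) ≤ ∑ ω, w ω * (Y ω * Zf) :=
    Finset.sum_le_sum fun ω _ => mul_le_mul_of_nonneg_left (hfib ω) (hw0 ω)
  have hXZ : ∑ ω, w ω * (X ω * Z) = (∑ ω, w ω * X ω) * Z := by
    rw [Finset.sum_mul]; exact Finset.sum_congr rfl fun ω _ => by ring
  have hYZ : ∑ ω, w ω * (Y ω * Zf) = (∑ ω, w ω * Y ω) * Zf := by
    rw [Finset.sum_mul]; exact Finset.sum_congr rfl fun ω _ => by ring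
  rw [hXZ, hYZ] at hsum
  calc (∑ ω, w ω * X ω) * ((∑ ω, w ω) * Z) = ((∑ ω, w ω * X ω) * Z) * ∑ ω, w ω := by ring
    _ ≤ ((∑ ω, w ω * Y ω) * Zf) * ∑ ω, w ω := mul_le_mul_of_nonneg_right hsum hS0
    _ = (∑ ω, w ω * Y ω) * ((∑ ω, w ω) * Zf) := by ring

/-- **Row 2′CD across a cut vertex separating `a₁` from `{a₂, a₃, o}`, from the far-side (AC).** -/
theorem cd_of_cut_root (p : E → R) (hp : IsProbVec p) (h : CutV.IsCut ends y VA VB EA EB)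
    {a₁ a₂ a₃ o : V} (ha₁ : a₁ ∈ VA ∪ {y}) (ha₂ : a₂ ∈ VB) (ho : o ∈ VB) (ha₃ : a₃ ∈ VB ∪ {y})
    {𝓔 : Set (Set V)} (h𝓔 : IsUpperSet 𝓔)
    (hAC : ∀ 𝓤 : Set (Set V), IsUpperSet 𝓤 →
      prob (fun e => if e ∈ EB then p e else 0) ((connEvent ends y a₂)ᶜ ∩ clusterInEvent ends y 𝓤 ∩
            connEvent ends y a₃ ∩ connEvent ends a₂ o) *
          prob (fun e => if e ∈ EB then p e else 0) ((connEvent ends y a₂)ᶜ ∩ connEvent ends y a₃) ≤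
        prob (fun e => if e ∈ EB then p e else 0) ((connEvent ends y a₂)ᶜ ∩ clusterInEvent ends y 𝓤 ∩
            connEvent ends y a₃) *
          prob (fun e => if e ∈ EB then p e else 0) ((connEvent ends y a₂)ᶜ ∩ connEvent ends y a₃ ∩
            connEvent ends a₂ o)) :
    let Q := (connEvent ends a₁ a₂)ᶜ
    let U := clusterInEvent ends a₁ 𝓔
    let e := connEvent ends a₁ a₃
    let f := connEvent ends a₂ o
    let N := (connEvent ends a₁ a₃)ᶜ ∩ (connEvent ends a₂ a₃)ᶜ
    let oU := connEvent ends a₁ o ∪ connEvent ends a₂ o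
    prob p (Q ∩ N) * (prob p Q * prob p (Q ∩ U ∩ e ∩ f) - prob p (Q ∩ U) * prob p (Q ∩ e ∩ f)) ≤
      prob p (Q ∩ N ∩ oU) * (prob p Q * prob p (Q ∩ U ∩ e) - prob p (Q ∩ U) * prob p (Q ∩ e)) :=
  CDRequired.cd_of_required_anticorr p hp ends a₁ a₂ a₃ o h𝓔
    (required_anticorr_of_cut_root p hp h ha₁ ha₂ ho ha₃ h𝓔 hAC)

/-! ## `a₃` beyond the cut -/

omit [Fintype E] [DecidableEq E] [Fintype V] [DecidableEq V] in
/-- The four `a₃`-required events when `a₃` lies beyond the cut vertex `v` and `a₁, a₂, o` on the near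
side, read on the two sides: the far-side event `{v ↔ a₃ in B}` and the near-side events of the
argument with the mark `v` in place of `a₃` and the up-set `𝓔_S = {W ∣ W ∪ C_B(v)(S) ∈ 𝓔}`. -/
lemma required_events_eq_far (h : CutV.IsCut ends y VA VB EA EB) {a₁ a₂ a₃ o : V}
    (ha₁ : a₁ ∈ VA ∪ {y}) (ha₂ : a₂ ∈ VA ∪ {y}) (ho : o ∈ VA ∪ {y}) (ha₃ : a₃ ∈ VB)
    (𝓔 : Set (Set V)) :
    ((connEvent ends a₁ a₂)ᶜ ∩ clusterInEvent ends a₁ 𝓔 ∩ connEvent ends a₁ a₃ ∩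
        connEvent ends a₂ o =
      {ω | restrict EB ω ∈ connEvent ends y a₃ ∧ restrict EA ω ∈
        ((connEvent ends a₁ a₂)ᶜ ∩
          clusterInEvent ends a₁ {W | W ∪ cluster ends (restrict EB ω) y ∈ 𝓔} ∩
          connEvent ends a₁ y ∩ connEvent ends a₂ o)}) ∧
    ((connEvent ends a₁ a₂)ᶜ ∩ connEvent ends a₁ a₃ =
      {ω | restrict EB ω ∈ connEvent ends y a₃ ∧ restrict EA ω ∈
        ((connEvent ends a₁ a₂)ᶜ ∩ connEvent ends a₁ y)}) ∧
    ((connEvent ends a₁ a₂)ᶜ ∩ clusterInEvent ends a₁ 𝓔 ∩ connEvent ends a₁ a₃ =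
      {ω | restrict EB ω ∈ connEvent ends y a₃ ∧ restrict EA ω ∈
        ((connEvent ends a₁ a₂)ᶜ ∩
          clusterInEvent ends a₁ {W | W ∪ cluster ends (restrict EB ω) y ∈ 𝓔} ∩
          connEvent ends a₁ y)}) ∧
    ((connEvent ends a₁ a₂)ᶜ ∩ connEvent ends a₁ a₃ ∩ connEvent ends a₂ o =
      {ω | restrict EB ω ∈ connEvent ends y a₃ ∧ restrict EA ω ∈
        ((connEvent ends a₁ a₂)ᶜ ∩ connEvent ends a₁ y ∩ connEvent ends a₂ o)}) := by
  have hQ : ∀ ω : Config E, Conn ends ω a₁ a₂ ↔ Conn ends (restrict EA ω) a₁ a₂ :=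
    fun ω => CutV.conn_iff_restrict h ha₁ ha₂
  have he : ∀ ω : Config E, Conn ends ω a₁ a₃ ↔
      Conn ends (restrict EA ω) a₁ y ∧ Conn ends (restrict EB ω) y a₃ :=
    fun ω => CDCutVertex.conn_iff_across_or_cut h ha₁ (Or.inl ha₃)
  have hF : ∀ ω : Config E, Conn ends ω a₂ o ↔ Conn ends (restrict EA ω) a₂ o :=
    fun ω => CutV.conn_iff_restrict h ha₂ ho
  have hU : ∀ ω : Config E, Conn ends (restrict EA ω) a₁ y →
      (cluster ends ω a₁ ∈ 𝓔 ↔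
        cluster ends (restrict EA ω) a₁ ∪ cluster ends (restrict EB ω) y ∈ 𝓔) :=
    fun ω hx => by rw [CDCutVertex.cluster_eq_union_or_cut h ha₁ hx]
  refine ⟨?_, ?_, ?_, ?_⟩ <;> ext ω <;>
    simp only [Set.mem_inter_iff, Set.mem_compl_iff, mem_connEvent, mem_clusterInEvent,
      Set.mem_setOf_eq] <;>
    have h1 := hQ ω <;> have h2 := he ω <;> have h3 := hF ω <;> have h4 := hU ω <;> tauto

omit [Fintype V] [DecidableEq V] in
/-- **(AC) across a cut vertex separating `a₃` from `{a₁, a₂, o}`: the far side is arbitrary.** If (AC)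
holds at `(a₁, a₂, v, o)` for every up-set under the vector with the far side closed, then (AC) holds
at `(a₁, a₂, a₃, o)` for every up-set `𝓔`, whatever the far side looks like. -/
theorem required_anticorr_of_cut_far (p : E → R) (hp : IsProbVec p)
    (h : CutV.IsCut ends y VA VB EA EB) {a₁ a₂ a₃ o : V} (ha₁ : a₁ ∈ VA ∪ {y}) (ha₂ : a₂ ∈ VA ∪ {y})
    (ho : o ∈ VA ∪ {y}) (ha₃ : a₃ ∈ VB) {𝓔 : Set (Set V)} (h𝓔 : IsUpperSet 𝓔)
    (hAC : ∀ 𝓤 : Set (Set V), IsUpperSet 𝓤 →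
      prob (fun e => if e ∈ EA then p e else 0) ((connEvent ends a₁ a₂)ᶜ ∩ clusterInEvent ends a₁ 𝓤 ∩
            connEvent ends a₁ y ∩ connEvent ends a₂ o) *
          prob (fun e => if e ∈ EA then p e else 0) ((connEvent ends a₁ a₂)ᶜ ∩ connEvent ends a₁ y) ≤
        prob (fun e => if e ∈ EA then p e else 0) ((connEvent ends a₁ a₂)ᶜ ∩ clusterInEvent ends a₁ 𝓤 ∩
            connEvent ends a₁ y) *
          prob (fun e => if e ∈ EA then p e else 0) ((connEvent ends a₁ a₂)ᶜ ∩ connEvent ends a₁ y ∩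
            connEvent ends a₂ o)) :
    prob p ((connEvent ends a₁ a₂)ᶜ ∩ clusterInEvent ends a₁ 𝓔 ∩ connEvent ends a₁ a₃ ∩
          connEvent ends a₂ o) * prob p ((connEvent ends a₁ a₂)ᶜ ∩ connEvent ends a₁ a₃) ≤
      prob p ((connEvent ends a₁ a₂)ᶜ ∩ clusterInEvent ends a₁ 𝓔 ∩ connEvent ends a₁ a₃) *
        prob p ((connEvent ends a₁ a₂)ᶜ ∩ connEvent ends a₁ a₃ ∩ connEvent ends a₂ o) := by
  obtain ⟨e1, e2, e3, e4⟩ := required_events_eq_far h ha₁ ha₂ ho ha₃ 𝓔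
  have t1 := CDCutVertex.prob_eq_sum_tower p EB EA h.Edisj.symm (connEvent ends y a₃) (fun S =>
    (connEvent ends a₁ a₂)ᶜ ∩ clusterInEvent ends a₁ {W | W ∪ cluster ends S y ∈ 𝓔} ∩
      connEvent ends a₁ y ∩ connEvent ends a₂ o)
  have t2 := CDCutVertex.prob_eq_sum_tower p EB EA h.Edisj.symm (connEvent ends y a₃) (fun _ =>
    (connEvent ends a₁ a₂)ᶜ ∩ connEvent ends a₁ y)
  have t3 := CDCutVertex.prob_eq_sum_tower p EB EA h.Edisj.symm (connEvent ends y a₃) (fun S =>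
    (connEvent ends a₁ a₂)ᶜ ∩ clusterInEvent ends a₁ {W | W ∪ cluster ends S y ∈ 𝓔} ∩
      connEvent ends a₁ y)
  have t4 := CDCutVertex.prob_eq_sum_tower p EB EA h.Edisj.symm (connEvent ends y a₃) (fun _ =>
    (connEvent ends a₁ a₂)ᶜ ∩ connEvent ends a₁ y ∩ connEvent ends a₂ o)
  rw [e1, e3, e4, e2, t1, t3, t4, t2]
  set w : Config E → R := fun ω => weight p ω * (connEvent ends y a₃).indicator 1 (restrict EB ω)
    with hw
  have hw0 : ∀ ω, 0 ≤ w ω := fun ω =>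
    mul_nonneg (weight_nonneg hp ω) (Set.indicator_apply_nonneg fun _ => zero_le_one)
  set Z := prob p (CutV.sideEvent EA ((connEvent ends a₁ a₂)ᶜ ∩ connEvent ends a₁ y)) with hZ
  set Zf := prob p (CutV.sideEvent EA ((connEvent ends a₁ a₂)ᶜ ∩ connEvent ends a₁ y ∩
    connEvent ends a₂ o)) with hZf
  set X : Config E → R := fun ω => prob p (CutV.sideEvent EA ((connEvent ends a₁ a₂)ᶜ ∩
    clusterInEvent ends a₁ {W | W ∪ cluster ends (restrict EB ω) y ∈ 𝓔} ∩
    connEvent ends a₁ y ∩ connEvent ends a₂ o)) with hX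
  set Y : Config E → R := fun ω => prob p (CutV.sideEvent EA ((connEvent ends a₁ a₂)ᶜ ∩
    clusterInEvent ends a₁ {W | W ∪ cluster ends (restrict EB ω) y ∈ 𝓔} ∩
    connEvent ends a₁ y)) with hY
  -- the fibrewise inequality: the near-side (AC) at `(a₁, a₂, v, o)` with the up-set `𝓔_S`
  have hfib : ∀ ω, X ω * Z ≤ Y ω * Zf := by
    intro ω
    simp only [hX, hY, hZ, hZf]
    rw [← CDCutVertex.prob_zeroOff_eq_prob_sideEvent, ← CDCutVertex.prob_zeroOff_eq_prob_sideEvent,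
      ← CDCutVertex.prob_zeroOff_eq_prob_sideEvent, ← CDCutVertex.prob_zeroOff_eq_prob_sideEvent]
    exact hAC _ (isUpperSet_union_right h𝓔 _)
  have hS0 : 0 ≤ ∑ ω, w ω := Finset.sum_nonneg fun ω _ => hw0 ω
  have sa : ∑ ω, weight p ω * ((connEvent ends y a₃).indicator 1 (restrict EB ω) * X ω) =
      ∑ ω, w ω * X ω := Finset.sum_congr rfl fun ω _ => by rw [hw]; ring
  have sb : ∑ ω, weight p ω * ((connEvent ends y a₃).indicator 1 (restrict EB ω) * Y ω) =
      ∑ ω, w ω * Y ω := Finset.sum_congr rfl fun ω _ => by rw [hw]; ring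
  have sd : ∑ ω, weight p ω * ((connEvent ends y a₃).indicator 1 (restrict EB ω) * Z) =
      (∑ ω, w ω) * Z := by
    rw [Finset.sum_mul]; exact Finset.sum_congr rfl fun ω _ => by rw [hw]; ring
  have sc : ∑ ω, weight p ω * ((connEvent ends y a₃).indicator 1 (restrict EB ω) * Zf) =
      (∑ ω, w ω) * Zf := by
    rw [Finset.sum_mul]; exact Finset.sum_congr rfl fun ω _ => by rw [hw]; ring
  show (∑ ω, weight p ω * ((connEvent ends y a₃).indicator 1 (restrict EB ω) * X ω)) *
      (∑ ω, weight p ω * ((connEvent ends y a₃).indicator 1 (restrict EB ω) * Z)) ≤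
    (∑ ω, weight p ω * ((connEvent ends y a₃).indicator 1 (restrict EB ω) * Y ω)) *
      (∑ ω, weight p ω * ((connEvent ends y a₃).indicator 1 (restrict EB ω) * Zf))
  rw [sa, sb, sc, sd]
  have hsum : ∑ ω, w ω * (X ω * Z) ≤ ∑ ω, w ω * (Y ω * Zf) :=
    Finset.sum_le_sum fun ω _ => mul_le_mul_of_nonneg_left (hfib ω) (hw0 ω)
  have hXZ : ∑ ω, w ω * (X ω * Z) = (∑ ω, w ω * X ω) * Z := by
    rw [Finset.sum_mul]; exact Finset.sum_congr rfl fun ω _ => by ring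
  have hYZ : ∑ ω, w ω * (Y ω * Zf) = (∑ ω, w ω * Y ω) * Zf := by
    rw [Finset.sum_mul]; exact Finset.sum_congr rfl fun ω _ => by ring
  rw [hXZ, hYZ] at hsum
  calc (∑ ω, w ω * X ω) * ((∑ ω, w ω) * Z) = ((∑ ω, w ω * X ω) * Z) * ∑ ω, w ω := by ring
    _ ≤ ((∑ ω, w ω * Y ω) * Zf) * ∑ ω, w ω := mul_le_mul_of_nonneg_right hsum hS0
    _ = (∑ ω, w ω * Y ω) * ((∑ ω, w ω) * Zf) := by ring

/-- **Row 2′CD with `a₃` beyond a cut vertex `v`, from (AC) at `(a₁, a₂, v, o)` on the near side**: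
the far side (everything hanging at `v` away from `a₁, a₂, o`) is arbitrary. -/
theorem cd_of_cut_far (p : E → R) (hp : IsProbVec p) (h : CutV.IsCut ends y VA VB EA EB)
    {a₁ a₂ a₃ o : V} (ha₁ : a₁ ∈ VA ∪ {y}) (ha₂ : a₂ ∈ VA ∪ {y}) (ho : o ∈ VA ∪ {y}) (ha₃ : a₃ ∈ VB)
    {𝓔 : Set (Set V)} (h𝓔 : IsUpperSet 𝓔)
    (hAC : ∀ 𝓤 : Set (Set V), IsUpperSet 𝓤 →
      prob (fun e => if e ∈ EA then p e else 0) ((connEvent ends a₁ a₂)ᶜ ∩ clusterInEvent ends a₁ 𝓤 ∩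
            connEvent ends a₁ y ∩ connEvent ends a₂ o) *
          prob (fun e => if e ∈ EA then p e else 0) ((connEvent ends a₁ a₂)ᶜ ∩ connEvent ends a₁ y) ≤
        prob (fun e => if e ∈ EA then p e else 0) ((connEvent ends a₁ a₂)ᶜ ∩ clusterInEvent ends a₁ 𝓤 ∩
            connEvent ends a₁ y) *
          prob (fun e => if e ∈ EA then p e else 0) ((connEvent ends a₁ a₂)ᶜ ∩ connEvent ends a₁ y ∩
            connEvent ends a₂ o)) :
    let Q := (connEvent ends a₁ a₂)ᶜ
    let U := clusterInEvent ends a₁ 𝓔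
    let e := connEvent ends a₁ a₃
    let f := connEvent ends a₂ o
    let N := (connEvent ends a₁ a₃)ᶜ ∩ (connEvent ends a₂ a₃)ᶜ
    let oU := connEvent ends a₁ o ∪ connEvent ends a₂ o
    prob p (Q ∩ N) * (prob p Q * prob p (Q ∩ U ∩ e ∩ f) - prob p (Q ∩ U) * prob p (Q ∩ e ∩ f)) ≤
      prob p (Q ∩ N ∩ oU) * (prob p Q * prob p (Q ∩ U ∩ e) - prob p (Q ∩ U) * prob p (Q ∩ e)) :=
  CDRequired.cd_of_required_anticorr p hp ends a₁ a₂ a₃ o h𝓔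
    (required_anticorr_of_cut_far p hp h ha₁ ha₂ ho ha₃ h𝓔 hAC)

/-! ## `o` beyond the cut -/

omit [Fintype V] [DecidableEq V] in
/-- **(AC) across a cut vertex separating `o` from `{a₁, a₂, a₃}`** (`𝓔` reading only the near side):
(AC) at `(a₁, a₂, a₃, z)` implies (AC) at `(a₁, a₂, a₃, o)` — the product law of `CDCutO`. -/
theorem required_anticorr_of_cut_o (p : E → R) (hp : IsProbVec p)
    (h : CutV.IsCut ends y VA VB EA EB) {a₁ a₂ a₃ o : V} (ha₁ : a₁ ∈ VA ∪ {y}) (ha₂ : a₂ ∈ VA ∪ {y})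
    (ha₃ : a₃ ∈ VA ∪ {y}) (ho : o ∈ VB) {𝓔 : Set (Set V)}
    (hside : ∀ S : Set V, S ∈ 𝓔 ↔ S ∩ (VA ∪ {y}) ∈ 𝓔)
    (hz : prob p ((connEvent ends a₁ a₂)ᶜ ∩ clusterInEvent ends a₁ 𝓔 ∩ connEvent ends a₁ a₃ ∩
          connEvent ends a₂ y) * prob p ((connEvent ends a₁ a₂)ᶜ ∩ connEvent ends a₁ a₃) ≤
      prob p ((connEvent ends a₁ a₂)ᶜ ∩ clusterInEvent ends a₁ 𝓔 ∩ connEvent ends a₁ a₃) *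
        prob p ((connEvent ends a₁ a₂)ᶜ ∩ connEvent ends a₁ a₃ ∩ connEvent ends a₂ y)) :
    prob p ((connEvent ends a₁ a₂)ᶜ ∩ clusterInEvent ends a₁ 𝓔 ∩ connEvent ends a₁ a₃ ∩
          connEvent ends a₂ o) * prob p ((connEvent ends a₁ a₂)ᶜ ∩ connEvent ends a₁ a₃) ≤
      prob p ((connEvent ends a₁ a₂)ᶜ ∩ clusterInEvent ends a₁ 𝓔 ∩ connEvent ends a₁ a₃) *
        prob p ((connEvent ends a₁ a₂)ᶜ ∩ connEvent ends a₁ a₃ ∩ connEvent ends a₂ o) := by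
  set H := CutV.sideEvent EB (connEvent ends y o) with hH
  have hf : connEvent ends a₂ o = connEvent ends a₂ y ∩ H := CDCutO.connEvent_o_eq h ha₂ ho
  have dQ : DependsOn (· ∈ (connEvent ends a₁ a₂)ᶜ) EA :=
    dependsOn_compl (CDCutO.dependsOn_connEvent_near h ha₁ ha₂)
  have dU : DependsOn (· ∈ clusterInEvent ends a₁ 𝓔) EA :=
    CDCutO.dependsOn_clusterInEvent_near h ha₁ hside
  have de : DependsOn (· ∈ connEvent ends a₁ a₃) EA := CDCutO.dependsOn_connEvent_near h ha₁ ha₃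
  have dfz : DependsOn (· ∈ connEvent ends a₂ y) EA :=
    CDCutO.dependsOn_connEvent_near h ha₂ (Or.inr rfl)
  have e1 : prob p ((connEvent ends a₁ a₂)ᶜ ∩ clusterInEvent ends a₁ 𝓔 ∩ connEvent ends a₁ a₃ ∩
      connEvent ends a₂ o) = prob p ((connEvent ends a₁ a₂)ᶜ ∩ clusterInEvent ends a₁ 𝓔 ∩
        connEvent ends a₁ a₃ ∩ connEvent ends a₂ y) * prob p H := by
    rw [hf, ← Set.inter_assoc]
    exact CDCutO.prob_inter_far p h (CDCutO.dependsOn_inter' (CDCutO.dependsOn_inter'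
      (CDCutO.dependsOn_inter' dQ dU) de) dfz) _
  have e2 : prob p ((connEvent ends a₁ a₂)ᶜ ∩ connEvent ends a₁ a₃ ∩ connEvent ends a₂ o) =
      prob p ((connEvent ends a₁ a₂)ᶜ ∩ connEvent ends a₁ a₃ ∩ connEvent ends a₂ y) * prob p H := by
    rw [hf, ← Set.inter_assoc]
    exact CDCutO.prob_inter_far p h (CDCutO.dependsOn_inter' (CDCutO.dependsOn_inter' dQ de) dfz) _
  have hρ : 0 ≤ prob p H := prob_nonneg hp _
  rw [e1, e2]
  calc prob p ((connEvent ends a₁ a₂)ᶜ ∩ clusterInEvent ends a₁ 𝓔 ∩ connEvent ends a₁ a₃ ∩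
          connEvent ends a₂ y) * prob p H * prob p ((connEvent ends a₁ a₂)ᶜ ∩ connEvent ends a₁ a₃)
      = (prob p ((connEvent ends a₁ a₂)ᶜ ∩ clusterInEvent ends a₁ 𝓔 ∩ connEvent ends a₁ a₃ ∩
          connEvent ends a₂ y) * prob p ((connEvent ends a₁ a₂)ᶜ ∩ connEvent ends a₁ a₃)) *
          prob p H := by ring
    _ ≤ (prob p ((connEvent ends a₁ a₂)ᶜ ∩ clusterInEvent ends a₁ 𝓔 ∩ connEvent ends a₁ a₃) *
          prob p ((connEvent ends a₁ a₂)ᶜ ∩ connEvent ends a₁ a₃ ∩ connEvent ends a₂ y)) *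
          prob p H := mul_le_mul_of_nonneg_right hz hρ
    _ = prob p ((connEvent ends a₁ a₂)ᶜ ∩ clusterInEvent ends a₁ 𝓔 ∩ connEvent ends a₁ a₃) *
          (prob p ((connEvent ends a₁ a₂)ᶜ ∩ connEvent ends a₁ a₃ ∩ connEvent ends a₂ y) *
            prob p H) := by ring

end Main

end CDCutAC

end Summit.Ventures.PercRepro2
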